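import Summits.RiemannHypothesis.RiemannHypothesis.Theorems.SignConeExactConeRigidityChain
import Summits.RiemannHypothesis.RiemannHypothesis.Theorems.SignConeExactConeRigidityCara
import Summits.RiemannHypothesis.RiemannHypothesis.Theorems.SignConeConeMagnificationSplit

/-!
# Route SignCone, item `ExactConeRigidity` (stmt-RiemannHypothesis-16306): the item in the post-split vocabulary

Crux `ConeMagnification` (stmt-RiemannHypothesis-16303) is being redirected (strategist BC2, `SPLIT-PROPOSAL.md` in
its crux directory) to the two zero-free pieces `SlackDesign → DeficitOfDesign`, glued by the landed
`ConeMagnification_of_subs` / `ConeMagnification_of_slackDesign` (p138305; `DeficitOfDesign` = the landed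
`stub_deficitOfDesign`, p137772).  This file records what that means for THIS item, by name:

* `ExactConeRigidity_of_slackDesign` — the proposed child `SlackDesign` (statement verbatim from the strategist's
  `children.json`) closes `ExactConeRigidity` outright (3-line composition through `ConeMagnification`).
* `ExactConeRigidity_of_exactDesignOfCara` — the slack-`0` analogue proper to this item, STRICTLY WEAKER than
  `SlackDesign` as a hypothesis: design data (AX-A, AX-B, AX-C with the same constant `1/2`) are required only of
  weights `c ≥ 0`, `c 1 = 0`, `Σ c(n) n^{-σ} < ∞` (`σ > 1`) admitting a holomorphic `F = L_c − 1/(s−1)` on `Re s > 1/2`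
  under the TIGHT Carathéodory majorant `Re F ≤ Re 1/s + 𝒜 − ½ log π` (no additive `1/2`; `exactWeight_cara`) — one
  nonnegative sequence and one holomorphic function, no Weil test, no zero of `ζ`.  Composition: exact sign cone ⇒ one
  exact weight (`exists_exactWeight_of_exactSignCone`) ⇒ analytic package (`exactWeight_continuation`) and tight
  majorant (`exactWeight_cara`) ⇒ design data (hypothesis) ⇒ prime-deficit summability beyond `1/2`
  (`stub_deficitOfDesign`) ⇒ RH (`stub_transfer`, Landau).

Neither hypothesis is proved here (they are the located open core of the 2001 magnification programme); the file only
certifies that each closes stmt-16306.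
-/

noncomputable section

-- `Summit.RiemannHypothesis.RiemannHypothesis.…` repeats a namespace component by design (D-0017 layout).
set_option linter.dupNamespace false

open scoped BigOperators ComplexConjugate Real Topology ArithmeticFunction.vonMangoldt
open Complex MeasureTheory Set Filter

namespace Summit.RiemannHypothesis.RiemannHypothesis.Theorems.SignConeExactConeRigidity

open Literature.NumberTheory.LFunctions
open Summit.RiemannHypothesis.RiemannHypothesis.Theorems.SignCone
open Summit.RiemannHypothesis.RiemannHypothesis.Theorems.SignConeConeMagnification
open Summit.RiemannHypothesis.RiemannHypothesis.Cruxes.ConeMagnification.Sketch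

/-- **`ExactConeRigidity` from the proposed child `SlackDesign` of crux `ConeMagnification`** (statement verbatim
from the strategist's `children.json`: unit slack against every Weil test, `Σ c(n) n^{-σ} < ∞` for `σ > 1` and the
slack-`1/2` Carathéodory majorant ⇒ design data AX-A ∧ AX-B ∧ AX-C).  Composition of the landed split glue
`ConeMagnification_of_slackDesign` (p138305) with `ExactConeRigidity_of_coneMagnification` (p128679). -/
theorem ExactConeRigidity_of_slackDesign
    (hSD : ∀ c : ℕ → ℝ, (∀ n, 0 ≤ c n) → c 1 = 0 →
      (∀ g : ℝ → ℂ, (ContDiff ℝ ((⊤ : ℕ∞) : WithTop ℕ∞) g ∧ HasCompactSupport g) →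
        let G : ℝ → ℂ := MeasureTheory.convolution g (fun u => (starRingEnd ℂ) (g (-u)))
          (ContinuousLinearMap.mul ℂ ℂ) MeasureTheory.MeasureSpace.volume;
        let M : ℂ → ℂ := fun s => ∫ u : ℝ, G u * Complex.exp ((s - 1 / 2) * u);
        -(∫ t, ‖g t‖ ^ 2) ≤ (M 0 + M 1 + ((1 / (2 * Real.pi) : ℂ) * (∫ t : ℝ, M (1 / 2 + t * Complex.I) *
          ((Complex.digamma (1 / 4 + t / 2 * Complex.I)).re : ℂ)) - G 0 * (Real.log Real.pi : ℂ)) -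
          ∑' n : ℕ, ((c n : ℝ) : ℂ) / (Real.sqrt n : ℂ) * (G (Real.log n) + G (-Real.log n))).re) →
      (∀ σ : ℝ, 1 < σ → LSeriesSummable (fun n => ((c n : ℝ) : ℂ)) σ) →
      (∃ F : ℂ → ℂ, DifferentiableOn ℂ F {s : ℂ | 1 / 2 < s.re} ∧
        (∀ s : ℂ, 1 < s.re → F s = LSeries (fun n => ((c n : ℝ) : ℂ)) s - 1 / (s - 1)) ∧
        ∀ s : ℂ, 1 / 2 < s.re →
          (F s).re ≤ 1 / 2 + (1 / s).re +
            1 / (2 * Real.pi) * (∫ v : ℝ, (Complex.digamma (1 / 4 + v / 2 * Complex.I)).re *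
              ((s.re - 1 / 2) / ((s.re - 1 / 2) ^ 2 + (s.im - v) ^ 2))) - Real.log Real.pi / 2) →
      Summable (fun n : ℕ => |c n - ArithmeticFunction.vonMangoldt n| / (n : ℝ)) ∧
      Summable (fun n : ℕ => if 2 ≤ n ∧ ¬ IsPrimePow n then
        c n / (n : ℝ) * (∑ q ∈ n.primeFactors, ∑ q' ∈ n.primeFactors.filter (fun q' => q < q'),
          ((Real.sqrt q - 1) / 2) * ((Real.sqrt q' - 1) / 2)) else 0) ∧
      (∀ S : Finset ℕ, (∀ p ∈ S, p.Prime) → ∀ a : ℕ → ℝ, (∀ p ∈ S, 0 ≤ a p ∧ a p ≤ 1) → ∀ φ : ℝ,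
        (∑' n : ℕ, (c n - ArithmeticFunction.vonMangoldt n) / (n : ℝ) *
          (if ∀ p ∈ S, ¬ (p ^ 2 ∣ n) then
            Real.sqrt (∏ p ∈ S.filter (· ∣ n), (p : ℝ)) * (∏ p ∈ S.filter (· ∣ n), a p) *
              (1 / 2) ^ (S.filter (· ∣ n)).card * Real.cos (((S.filter (· ∣ n)).card : ℝ) * φ)
          else 0)) ≤ 1 / 2)) :
    Theses.SignCone.ExactConeRigidity :=
  ExactConeRigidity_of_coneMagnification (ConeMagnification_of_slackDesign hSD)

/-- **`ExactConeRigidity` from the slack-`0` design core** (ζ-free; strictly weaker than `SlackDesign` as a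
hypothesis).  If for every `c ≥ 0`, `c 1 = 0`, `Σ c(n) n^{-σ} < ∞` (`σ > 1`), a holomorphic `F` on `Re s > 1/2`
continuing `L_c − 1/(s−1)` under the TIGHT majorant `Re F(s) ≤ Re (1/s) + 𝒜(s) − ½ log π` forces the design data —
(AX-A) `Σ |c(n) − Λ(n)|/n < ∞`, (AX-B) summable composite mass, (AX-C) the Riesz–Euler design inequality with constant
`1/2` — then the route item `ExactConeRigidity` holds: one exact weight exists (`exists_exactWeight_of_exactSignCone`),
carries the analytic package (`exactWeight_continuation`) and the tight majorant (`exactWeight_cara`), the hypothesis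
gives its design data, `stub_deficitOfDesign` (p137772) the prime-deficit summability beyond `1/2`, and the Landau
transfer `stub_transfer` (p130783) concludes RH. -/
theorem ExactConeRigidity_of_exactDesignOfCara
    (hED : ∀ c : ℕ → ℝ, (∀ n, 0 ≤ c n) → c 1 = 0 →
      (∀ σ : ℝ, 1 < σ → LSeriesSummable (fun n => ((c n : ℝ) : ℂ)) σ) →
      (∃ F : ℂ → ℂ, DifferentiableOn ℂ F {s : ℂ | 1 / 2 < s.re} ∧
        (∀ s : ℂ, 1 < s.re → F s = LSeries (fun n => ((c n : ℝ) : ℂ)) s - 1 / (s - 1)) ∧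
        ∀ s : ℂ, 1 / 2 < s.re →
          (F s).re ≤ (1 / s).re +
            1 / (2 * Real.pi) * (∫ v : ℝ, (Complex.digamma (1 / 4 + v / 2 * Complex.I)).re *
              ((s.re - 1 / 2) / ((s.re - 1 / 2) ^ 2 + (s.im - v) ^ 2))) - Real.log Real.pi / 2) →
      Summable (fun n : ℕ => |c n - ArithmeticFunction.vonMangoldt n| / (n : ℝ)) ∧
      Summable (fun n : ℕ => if 2 ≤ n ∧ ¬ IsPrimePow n then
        c n / (n : ℝ) * (∑ q ∈ n.primeFactors, ∑ q' ∈ n.primeFactors.filter (fun q' => q < q'),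
          ((Real.sqrt q - 1) / 2) * ((Real.sqrt q' - 1) / 2)) else 0) ∧
      (∀ S : Finset ℕ, (∀ p ∈ S, p.Prime) → ∀ a : ℕ → ℝ, (∀ p ∈ S, 0 ≤ a p ∧ a p ≤ 1) → ∀ φ : ℝ,
        (∑' n : ℕ, (c n - ArithmeticFunction.vonMangoldt n) / (n : ℝ) *
          (if ∀ p ∈ S, ¬ (p ^ 2 ∣ n) then
            Real.sqrt (∏ p ∈ S.filter (· ∣ n), (p : ℝ)) * (∏ p ∈ S.filter (· ∣ n), a p) *
              (1 / 2) ^ (S.filter (· ∣ n)).card * Real.cos (((S.filter (· ∣ n)).card : ℝ) * φ)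
          else 0)) ≤ 1 / 2)) :
    Theses.SignCone.ExactConeRigidity := by
  intro hexact
  obtain ⟨c, hc0, hc1, hU0⟩ := exists_exactWeight_of_exactSignCone hexact
  obtain ⟨hsum, hcont⟩ := exactWeight_continuation hc0 hU0
  obtain ⟨hA, hB, hC⟩ := hED c hc0 hc1 hsum (exactWeight_cara hU0 hc0 hc1)
  exact stub_transfer c hc0 hsum hcont (stub_deficitOfDesign c hc0 hc1 hA hB hC)

end Summit.RiemannHypothesis.RiemannHypothesis.Theorems.SignConeExactConeRigidity

end
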